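import Mathlib
import Summits.KontsevichZagierPeriods.KontsevichZagierPeriods.Theorems.SoloInformedCubeResolution
import HarnessLib

/-!
# SoloInformed — algebra of cube germs

Cube germs (`SoloInformedCubeGerm n`: holomorphic near the closed unit cube, real on real points,
algebraic over `ℚ(z₁, …, zₙ)`) are closed under products, sums and polynomial substitutions
`z = κ(s)`, `κ ∈ ℚ[s]ⁿ` (injective on polynomials). Algebraicity of products and sums is reduced to
Mathlib's `IsAlgebraic.mul/add` over `ℚ[z]` acting on the function algebra `U → ℂ` by the BRIDGE
`soloInformed_mem_algFns_iff` (`∃ P ≠ 0, P(z, g z) = 0 on U` ↔ `IsAlgebraic ℚ[z] (g|_U)`).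
Main: `soloInformedΨ` (last variable ↦ `T`), `soloInformedAlgFns`, `SoloInformedCubeGerm.mul/add/comp`.
References: Ayoub 2014 §2.2 (the generators); Lang, Algebra, V §1 (algebraic elements form a ring).
-/

noncomputable section

open scoped BigOperators
open Set Polynomial
open Literature.NumberTheory.Transcendental

namespace Summit.KontsevichZagierPeriods.KontsevichZagierPeriods.Theorems

variable {n : ℕ}

/-! ### The last-variable isomorphism `ℚ[z, T] → ℚ[z][T]` -/

/-- `Ψ : ℚ[z₁, …, zₙ, T] → ℚ[z][T]`, `z_i ↦ C z_i`, `T ↦ X` (the last variable is `T`). -/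
def soloInformedΨ (n : ℕ) :
    MvPolynomial (Fin (n + 1)) ℚ →ₐ[ℚ] Polynomial (MvPolynomial (Fin n) ℚ) :=
  MvPolynomial.aeval (Fin.snoc (fun i => Polynomial.C (MvPolynomial.X i)) Polynomial.X)

/-- The substitution `Ψ` sends the last variable to the distinguished new variable (simp form). -/
@[simp] theorem soloInformedΨ_X_last (n : ℕ) :
    soloInformedΨ n (MvPolynomial.X (Fin.last n)) = Polynomial.X := by
  simp [soloInformedΨ]

/-- The substitution `Ψ` fixes the first `n` variables (simp form). -/
@[simp] theorem soloInformedΨ_X_castSucc (n : ℕ) (i : Fin n) :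
    soloInformedΨ n (MvPolynomial.X (Fin.castSucc i)) = Polynomial.C (MvPolynomial.X i) := by
  simp [soloInformedΨ]

/-- `Ψ` on polynomials not involving `T` is the coefficient embedding `C`. [folklore] -/
theorem soloInformedΨ_rename (n : ℕ) (a : MvPolynomial (Fin n) ℚ) :
    soloInformedΨ n (MvPolynomial.rename Fin.castSucc a) = Polynomial.C a := by
  have h : ((soloInformedΨ n).comp (MvPolynomial.rename Fin.castSucc)) =
      (Polynomial.CAlgHom :
        MvPolynomial (Fin n) ℚ →ₐ[ℚ] Polynomial (MvPolynomial (Fin n) ℚ)) := by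
    refine MvPolynomial.algHom_ext fun i => ?_
    simp [soloInformedΨ, MvPolynomial.rename_X]
  have h' := congrArg (fun φ => φ a) h
  simpa using h'

/-- Evaluation of `p ∈ ℚ[z][T]` at `(z, w) ∈ ℂⁿ × ℂ`. -/
def soloInformedEv (z : Fin n → ℂ) (w : ℂ) : Polynomial (MvPolynomial (Fin n) ℚ) →+* ℂ :=
  Polynomial.eval₂RingHom (MvPolynomial.aeval z).toRingHom w

/-- **Evaluation identity**: `Ψ P` evaluated at `(z, w)` is `P(z, w)`. [folklore] -/
theorem soloInformed_ev_Ψ (z : Fin n → ℂ) (w : ℂ) (P : MvPolynomial (Fin (n + 1)) ℚ) :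
    soloInformedEv z w (soloInformedΨ n P) = MvPolynomial.aeval (Fin.snoc z w) P := by
  have h : (soloInformedEv z w).comp (soloInformedΨ n).toRingHom =
      (MvPolynomial.aeval (Fin.snoc z w)).toRingHom := by
    refine MvPolynomial.ringHom_ext (fun q => ?_) (fun j => ?_)
    · simp [soloInformedEv, soloInformedΨ, MvPolynomial.algebraMap_eq]
    · induction j using Fin.lastCases with
      | last => simp [soloInformedEv]
      | cast i => simp [soloInformedEv]
  exact congrArg (fun φ : MvPolynomial (Fin (n + 1)) ℚ →+* ℂ => φ P) h

/-- `Ψ` is injective (semantically: `P` is determined by its values on `ℚⁿ⁺¹`). [folklore] -/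
theorem soloInformedΨ_ne_zero {P : MvPolynomial (Fin (n + 1)) ℚ} (hP : P ≠ 0) :
    soloInformedΨ n P ≠ 0 := by
  intro h
  apply hP
  apply MvPolynomial.funext
  intro x
  rw [map_zero]
  have h1 := soloInformed_ev_Ψ (fun i => ((x (Fin.castSucc i) : ℚ) : ℂ)) (x (Fin.last n)) P
  rw [h, map_zero] at h1
  have hx : (Fin.snoc (α := fun _ => ℂ) (fun i => ((x (Fin.castSucc i) : ℚ) : ℂ))
      ((x (Fin.last n) : ℚ) : ℂ)) = fun j => ((x j : ℚ) : ℂ) := by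
    funext j
    induction j using Fin.lastCases with
    | last => simp
    | cast i => simp
  rw [hx] at h1
  have h2 : ((MvPolynomial.eval x P : ℚ) : ℂ) =
      MvPolynomial.aeval (fun j => ((x j : ℚ) : ℂ)) P := by
    have h3 := MvPolynomial.eval₂_comp_left (algebraMap ℚ ℂ) (RingHom.id ℚ) x P
    simp only [RingHom.comp_id] at h3
    rw [MvPolynomial.aeval_def]
    convert h3 using 1
    · rw [eq_ratCast]
      rfl
    · congr 1
  exact_mod_cast h2.trans h1.symm

/-- `Ψ` is surjective. [folklore] -/
theorem soloInformedΨ_surjective (n : ℕ) : Function.Surjective (soloInformedΨ n) := by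
  intro p
  refine ⟨∑ i ∈ p.support, MvPolynomial.rename Fin.castSucc (p.coeff i) *
    MvPolynomial.X (Fin.last n) ^ i, ?_⟩
  rw [map_sum]
  conv_rhs => rw [p.as_sum_support_C_mul_X_pow]
  refine Finset.sum_congr rfl fun i _ => ?_
  rw [map_mul, map_pow, soloInformedΨ_rename, soloInformedΨ_X_last]

/-! ### The function algebra on `U` and the bridge -/

/-- Coordinate functions on `U ⊆ ℂⁿ`. -/
def soloInformedCoordFn (U : Set (Fin n → ℂ)) (i : Fin n) : ↥U → ℂ := fun z => (z : Fin n → ℂ) i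

/-- The `ℚ[z₁, …, zₙ]`-algebra structure on functions `U → ℂ` (evaluation of polynomials). -/
@[reducible] def soloInformedFnAlgebra (U : Set (Fin n → ℂ)) :
    Algebra (MvPolynomial (Fin n) ℚ) (↥U → ℂ) :=
  (MvPolynomial.aeval (soloInformedCoordFn U)).toRingHom.toAlgebra

attribute [local instance] soloInformedFnAlgebra

/-- The structure map evaluates polynomials pointwise. [folklore] -/
theorem soloInformed_algebraMap_fn_apply (U : Set (Fin n → ℂ)) (a : MvPolynomial (Fin n) ℚ)
    (z : ↥U) : algebraMap (MvPolynomial (Fin n) ℚ) (↥U → ℂ) a z =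
      MvPolynomial.aeval (z : Fin n → ℂ) a := by
  change (MvPolynomial.aeval (soloInformedCoordFn U) a) z = _
  have h : (Pi.evalAlgHom ℚ (fun _ : ↥U => ℂ) z).comp (MvPolynomial.aeval (soloInformedCoordFn U))
      = MvPolynomial.aeval (z : Fin n → ℂ) := by
    rw [MvPolynomial.comp_aeval]
    rfl
  exact congrArg (fun φ => φ a) h

/-- Pointwise evaluation of `aeval g p` in the function algebra. [folklore] -/
theorem soloInformed_aeval_fn_apply (U : Set (Fin n → ℂ)) (g : ↥U → ℂ)
    (p : Polynomial (MvPolynomial (Fin n) ℚ)) (z : ↥U) :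
    (Polynomial.aeval g p) z = soloInformedEv (z : Fin n → ℂ) (g z) p := by
  have h : (Pi.evalRingHom (fun _ : ↥U => ℂ) z).comp
      (Polynomial.aeval g : Polynomial (MvPolynomial (Fin n) ℚ) →ₐ[MvPolynomial (Fin n) ℚ]
        (↥U → ℂ)).toRingHom = soloInformedEv (z : Fin n → ℂ) (g z) := by
    refine Polynomial.ringHom_ext (fun a => ?_) ?_
    · simp only [RingHom.coe_comp, Function.comp_apply, AlgHom.toRingHom_eq_coe, RingHom.coe_coe,
        Polynomial.aeval_C, Pi.evalRingHom_apply, soloInformed_algebraMap_fn_apply]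
      simp [soloInformedEv]
    · simp [soloInformedEv]
  exact congrArg (fun φ : Polynomial (MvPolynomial (Fin n) ℚ) →+* ℂ => φ p) h

/-- Functions on `U` algebraic over `ℚ(z)` in the pointwise (germ) encoding. -/
def soloInformedAlgFns (U : Set (Fin n → ℂ)) : Set ((Fin n → ℂ) → ℂ) :=
  {g | ∃ P : MvPolynomial (Fin (n + 1)) ℚ, P ≠ 0 ∧
    ∀ z ∈ U, MvPolynomial.aeval (Fin.snoc z (g z)) P = 0}

/-- **The bridge.** The pointwise encoding of algebraicity on `U` is `IsAlgebraic ℚ[z]` of the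
restriction in the function algebra `U → ℂ`. [Lang, Algebra, V §1] -/
theorem soloInformed_mem_algFns_iff (U : Set (Fin n → ℂ)) (g : (Fin n → ℂ) → ℂ) :
    g ∈ soloInformedAlgFns U ↔
      IsAlgebraic (MvPolynomial (Fin n) ℚ) (fun z : ↥U => g z) := by
  constructor
  · rintro ⟨P, hP0, hP⟩
    refine ⟨soloInformedΨ n P, soloInformedΨ_ne_zero hP0, funext fun z => ?_⟩
    rw [soloInformed_aeval_fn_apply, soloInformed_ev_Ψ]
    exact hP z z.2
  · rintro ⟨p, hp0, hp⟩
    obtain ⟨P, rfl⟩ := soloInformedΨ_surjective n p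
    refine ⟨P, fun h => hp0 (by rw [h, map_zero]), fun z hz => ?_⟩
    have := congr_fun hp ⟨z, hz⟩
    rwa [soloInformed_aeval_fn_apply, soloInformed_ev_Ψ] at this

/-- Restriction to a smaller set preserves the encoding. -/
theorem soloInformed_algFns_mono {U V : Set (Fin n → ℂ)} (h : V ⊆ U) :
    soloInformedAlgFns U ⊆ soloInformedAlgFns V := fun _ ⟨P, hP0, hP⟩ =>
  ⟨P, hP0, fun z hz => hP z (h hz)⟩

/-- Products of algebraic functions are algebraic. [Lang, Algebra, V §1, Prop. 1.4] -/
theorem soloInformed_mul_mem_algFns {U : Set (Fin n → ℂ)} {g₁ g₂ : (Fin n → ℂ) → ℂ}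
    (h₁ : g₁ ∈ soloInformedAlgFns U) (h₂ : g₂ ∈ soloInformedAlgFns U) :
    (fun z => g₁ z * g₂ z) ∈ soloInformedAlgFns U := by
  rw [soloInformed_mem_algFns_iff] at h₁ h₂ ⊢
  exact h₁.mul h₂

/-- Sums of algebraic functions are algebraic. [Lang, Algebra, V §1, Prop. 1.4] -/
theorem soloInformed_add_mem_algFns {U : Set (Fin n → ℂ)} {g₁ g₂ : (Fin n → ℂ) → ℂ}
    (h₁ : g₁ ∈ soloInformedAlgFns U) (h₂ : g₂ ∈ soloInformedAlgFns U) :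
    (fun z => g₁ z + g₂ z) ∈ soloInformedAlgFns U := by
  rw [soloInformed_mem_algFns_iff] at h₁ h₂ ⊢
  exact h₁.add h₂

/-! ### Germs over a set `S ⊆ ℝⁿ` and their algebra -/

/-- A **germ over `S`**: a function holomorphic on an open `U ⊇ S` (complexified), real on real
points, algebraic over `ℚ(z)` on `U`. `S = [0,1]ⁿ` gives cube germs (`toCubeGerm`). -/
structure SoloInformedGermOn (n : ℕ) (S : Set (Fin n → ℝ)) where
  /-- the domain -/
  U : Set (Fin n → ℂ)
  /-- the function -/
  g : (Fin n → ℂ) → ℂ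
  isOpen : IsOpen U
  mapsTo : MapsTo (soloInformedToC n) S U
  analytic : AnalyticOnNhd ℂ g U
  real : ∀ x : Fin n → ℝ, soloInformedToC n x ∈ U → (g (soloInformedToC n x)).im = 0
  algebraic : g ∈ soloInformedAlgFns U

/-- A cube germ is a germ over the cube. -/
def SoloInformedCubeGerm.toGermOn (G : SoloInformedCubeGerm n) :
    SoloInformedGermOn n (soloInformedCube n) :=
  ⟨G.U, G.g, G.isOpen, G.mapsTo, G.analytic, G.real, G.algebraic⟩

/-- A germ over the cube is a cube germ. -/
def SoloInformedGermOn.toCubeGerm (G : SoloInformedGermOn n (soloInformedCube n)) :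
    SoloInformedCubeGerm n :=
  ⟨G.U, G.g, G.isOpen, G.mapsTo, G.analytic, G.real, G.algebraic⟩

/-- Underlying function of the cube germ obtained from a germ on the cube. -/
@[simp] theorem SoloInformedGermOn.toCubeGerm_g (G : SoloInformedGermOn n (soloInformedCube n)) :
    G.toCubeGerm.g = G.g := rfl

/-- Underlying function of the germ-on-a-set obtained from a cube germ. -/
@[simp] theorem SoloInformedCubeGerm.toGermOn_g (G : SoloInformedCubeGerm n) :
    G.toGermOn.g = G.g := rfl

namespace SoloInformedGermOn

variable {S : Set (Fin n → ℝ)}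

/-- Restriction of the base set. -/
def mono {S' : Set (Fin n → ℝ)} (G : SoloInformedGermOn n S) (h : S' ⊆ S) :
    SoloInformedGermOn n S' :=
  ⟨G.U, G.g, G.isOpen, G.mapsTo.mono_left h, G.analytic, G.real, G.algebraic⟩

/-- Restricting a germ to a smaller set does not change its function. -/
@[simp] theorem mono_g {S' : Set (Fin n → ℝ)} (G : SoloInformedGermOn n S) (h : S' ⊆ S) :
    (G.mono h).g = G.g := rfl

/-- **Product of germs.** [Lang, Algebra, V §1, Prop. 1.4 for the algebraicity] -/
def mul (G₁ G₂ : SoloInformedGermOn n S) : SoloInformedGermOn n S where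
  U := G₁.U ∩ G₂.U
  g z := G₁.g z * G₂.g z
  isOpen := G₁.isOpen.inter G₂.isOpen
  mapsTo x hx := ⟨G₁.mapsTo hx, G₂.mapsTo hx⟩
  analytic := (G₁.analytic.mono inter_subset_left).mul (G₂.analytic.mono inter_subset_right)
  real x hx := by simp [Complex.mul_im, G₁.real x hx.1, G₂.real x hx.2]
  algebraic :=
    soloInformed_mul_mem_algFns (soloInformed_algFns_mono inter_subset_left G₁.algebraic)
      (soloInformed_algFns_mono inter_subset_right G₂.algebraic)

/-- The function of a product of germs is the pointwise product. -/
@[simp] theorem mul_g (G₁ G₂ : SoloInformedGermOn n S) (z : Fin n → ℂ) :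
    (G₁.mul G₂).g z = G₁.g z * G₂.g z := rfl

/-- The domain of a product of germs is the intersection of the domains. -/
theorem mul_U (G₁ G₂ : SoloInformedGermOn n S) : (G₁.mul G₂).U = G₁.U ∩ G₂.U := rfl

/-- **Sum of germs.** [Lang, Algebra, V §1, Prop. 1.4 for the algebraicity] -/
def add (G₁ G₂ : SoloInformedGermOn n S) : SoloInformedGermOn n S where
  U := G₁.U ∩ G₂.U
  g z := G₁.g z + G₂.g z
  isOpen := G₁.isOpen.inter G₂.isOpen
  mapsTo x hx := ⟨G₁.mapsTo hx, G₂.mapsTo hx⟩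
  analytic := (G₁.analytic.mono inter_subset_left).add (G₂.analytic.mono inter_subset_right)
  real x hx := by simp [Complex.add_im, G₁.real x hx.1, G₂.real x hx.2]
  algebraic :=
    soloInformed_add_mem_algFns (soloInformed_algFns_mono inter_subset_left G₁.algebraic)
      (soloInformed_algFns_mono inter_subset_right G₂.algebraic)

/-- The function of a sum of germs is the pointwise sum. -/
@[simp] theorem add_g (G₁ G₂ : SoloInformedGermOn n S) (z : Fin n → ℂ) :
    (G₁.add G₂).g z = G₁.g z + G₂.g z := rfl

/-- On real points of the domain of a product germ, real parts multiply. -/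
theorem mul_re (G₁ G₂ : SoloInformedGermOn n S) (x : Fin n → ℝ)
    (hx : soloInformedToC n x ∈ (G₁.mul G₂).U) :
    ((G₁.mul G₂).g (soloInformedToC n x)).re =
      (G₁.g (soloInformedToC n x)).re * (G₂.g (soloInformedToC n x)).re := by
  simp [Complex.mul_re, G₁.real x hx.1, G₂.real x hx.2]

end SoloInformedGermOn

/-! ### Composition with polynomial substitutions -/

section Comp

variable {m : ℕ}

/-- The real polynomial map `κ_p : ℝᵐ → ℝⁿ` of `p ∈ ℚ[s₁, …, sₘ]ⁿ`. -/
def soloInformedPolyMap (p : Fin n → MvPolynomial (Fin m) ℚ) (x : Fin m → ℝ) : Fin n → ℝ :=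
  fun j => MvPolynomial.aeval x (p j)

/-- Its complexification `κ_p : ℂᵐ → ℂⁿ`. -/
def soloInformedPolyMapC (p : Fin n → MvPolynomial (Fin m) ℚ) (z : Fin m → ℂ) : Fin n → ℂ :=
  fun j => MvPolynomial.aeval z (p j)

/-- Evaluation formula for the real polynomial map attached to a tuple of `ℚ`-polynomials. -/
@[simp] theorem soloInformedPolyMap_apply (p : Fin n → MvPolynomial (Fin m) ℚ) (x : Fin m → ℝ)
    (j : Fin n) : soloInformedPolyMap p x j = MvPolynomial.aeval x (p j) := rfl

/-- Evaluation formula for the complex polynomial map attached to a tuple of `ℚ`-polynomials. -/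
@[simp] theorem soloInformedPolyMapC_apply (p : Fin n → MvPolynomial (Fin m) ℚ) (z : Fin m → ℂ)
    (j : Fin n) : soloInformedPolyMapC p z j = MvPolynomial.aeval z (p j) := rfl

/-- Complexification commutes with `κ_p`. -/
theorem soloInformed_toC_polyMap (p : Fin n → MvPolynomial (Fin m) ℚ) (x : Fin m → ℝ) :
    soloInformedToC n (soloInformedPolyMap p x) = soloInformedPolyMapC p (soloInformedToC m x) := by
  funext j
  simp only [soloInformedToC_apply, soloInformedPolyMap_apply, soloInformedPolyMapC_apply,
    soloInformed_ofReal_aeval]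
  rfl

/-- `κ_p` is entire. -/
theorem soloInformed_analyticOnNhd_polyMapC (p : Fin n → MvPolynomial (Fin m) ℚ) :
    AnalyticOnNhd ℂ (soloInformedPolyMapC p) univ := fun z _ =>
  analyticAt_pi_iff.mpr fun j => soloInformed_analyticOnNhd_aeval (p j) z trivial

/-- `κ_p` is continuous. -/
theorem soloInformed_continuous_polyMapC (p : Fin n → MvPolynomial (Fin m) ℚ) :
    Continuous (soloInformedPolyMapC p) :=
  continuous_pi fun j => (soloInformed_analyticOnNhd_aeval (p j)).continuous

/-- The substitution `θ_p : ℚ[z₁, …, zₙ, T] → ℚ[s₁, …, sₘ, T]`, `z_j ↦ p_j(s)`, `T ↦ T`. -/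
def soloInformedSubst (p : Fin n → MvPolynomial (Fin m) ℚ) :
    MvPolynomial (Fin (n + 1)) ℚ →ₐ[ℚ] MvPolynomial (Fin (m + 1)) ℚ :=
  MvPolynomial.aeval
    (Fin.snoc (fun j => MvPolynomial.rename Fin.castSucc (p j)) (MvPolynomial.X (Fin.last m)))

/-- **Substitution identity**: `(θ_p P)(s, t) = P(κ_p(s), t)`. [folklore] -/
theorem soloInformed_aeval_subst {A : Type*} [CommRing A] [Algebra ℚ A]
    (p : Fin n → MvPolynomial (Fin m) ℚ) (s : Fin m → A) (t : A)
    (P : MvPolynomial (Fin (n + 1)) ℚ) :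
    MvPolynomial.aeval (Fin.snoc s t) (soloInformedSubst p P) =
      MvPolynomial.aeval (Fin.snoc (fun j => MvPolynomial.aeval s (p j)) t) P := by
  have h : (MvPolynomial.aeval (Fin.snoc s t)).comp (soloInformedSubst p) =
      MvPolynomial.aeval (Fin.snoc (α := fun _ => A) (fun j => MvPolynomial.aeval s (p j)) t) := by
    rw [soloInformedSubst, MvPolynomial.comp_aeval]
    congr 1
    funext j
    induction j using Fin.lastCases with
    | last => simp
    | cast i => simp [MvPolynomial.aeval_rename, Fin.snoc_comp_castSucc]
  exact congrArg (fun φ => φ P) h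

/-- **Composition of a germ with a polynomial substitution** mapping `S'` into `S`, injective on
`ℚ[z, T]` (a dominance condition guaranteeing the minimal polynomial does not collapse). -/
def SoloInformedGermOn.comp {S : Set (Fin n → ℝ)} {S' : Set (Fin m → ℝ)}
    (G : SoloInformedGermOn n S) (p : Fin n → MvPolynomial (Fin m) ℚ)
    (hmaps : MapsTo (soloInformedPolyMap p) S' S)
    (hinj : ∀ Q, soloInformedSubst p Q = 0 → Q = 0) : SoloInformedGermOn m S' where
  U := soloInformedPolyMapC p ⁻¹' G.U
  g s := G.g (soloInformedPolyMapC p s)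
  isOpen := G.isOpen.preimage (soloInformed_continuous_polyMapC p)
  mapsTo x hx := by
    show soloInformedPolyMapC p (soloInformedToC m x) ∈ G.U
    rw [← soloInformed_toC_polyMap]
    exact G.mapsTo (hmaps hx)
  analytic s hs := (G.analytic _ hs).comp (soloInformed_analyticOnNhd_polyMapC p s trivial)
  real x hx := by
    have hx' : soloInformedToC n (soloInformedPolyMap p x) ∈ G.U := by
      rwa [soloInformed_toC_polyMap]
    have h := G.real _ hx'
    rwa [soloInformed_toC_polyMap] at h
  algebraic := by
    obtain ⟨P, hP0, hP⟩ := G.algebraic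
    refine ⟨soloInformedSubst p P, fun h => hP0 (hinj P h), fun s hs => ?_⟩
    rw [soloInformed_aeval_subst]
    exact hP _ hs

/-- The function of a pulled-back germ is the composite with the polynomial map. -/
@[simp] theorem SoloInformedGermOn.comp_g {S : Set (Fin n → ℝ)} {S' : Set (Fin m → ℝ)}
    (G : SoloInformedGermOn n S) (p : Fin n → MvPolynomial (Fin m) ℚ)
    (hmaps : MapsTo (soloInformedPolyMap p) S' S) (hinj : ∀ Q, soloInformedSubst p Q = 0 → Q = 0)
    (s : Fin m → ℂ) : (G.comp p hmaps hinj).g s = G.g (soloInformedPolyMapC p s) := rfl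

/-- The domain of a pulled-back germ is the preimage of the domain. -/
theorem SoloInformedGermOn.comp_U {S : Set (Fin n → ℝ)} {S' : Set (Fin m → ℝ)}
    (G : SoloInformedGermOn n S) (p : Fin n → MvPolynomial (Fin m) ℚ)
    (hmaps : MapsTo (soloInformedPolyMap p) S' S) (hinj : ∀ Q, soloInformedSubst p Q = 0 → Q = 0) :
    (G.comp p hmaps hinj).U = soloInformedPolyMapC p ⁻¹' G.U := rfl

/-- Polynomial germs over any `S` (from the polynomial cube germ, whose domain is all of `ℂⁿ`). -/
def soloInformedPolyGermOn (S : Set (Fin n → ℝ)) (q : MvPolynomial (Fin n) ℚ) :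
    SoloInformedGermOn n S :=
  ⟨(soloInformedPolynomialGerm q).U, (soloInformedPolynomialGerm q).g,
    (soloInformedPolynomialGerm q).isOpen, fun x _ => by simp [soloInformedPolynomialGerm,
      soloInformedRationalGerm], (soloInformedPolynomialGerm q).analytic,
    fun x _ => by
      simp only [soloInformedPolynomialGerm, soloInformedRationalGerm, map_one, div_one]
      rw [show soloInformedToC n x = fun i => ((x i : ℝ) : ℂ) from rfl,
        ← soloInformed_ofReal_aeval, Complex.ofReal_im],
    (soloInformedPolynomialGerm q).algebraic⟩

/-- The function of the germ of a `ℚ`-polynomial is its complex evaluation. -/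
@[simp] theorem soloInformedPolyGermOn_g (S : Set (Fin n → ℝ)) (q : MvPolynomial (Fin n) ℚ)
    (z : Fin n → ℂ) : (soloInformedPolyGermOn S q).g z = MvPolynomial.aeval z q := by
  simp [soloInformedPolyGermOn, soloInformedPolynomialGerm, soloInformedRationalGerm]

/-- The germ of a `ℚ`-polynomial is defined on all of `ℂⁿ`. -/
theorem soloInformedPolyGermOn_U (S : Set (Fin n → ℝ)) (q : MvPolynomial (Fin n) ℚ) :
    (soloInformedPolyGermOn S q).U = {z | MvPolynomial.aeval z (1 : MvPolynomial (Fin n) ℚ) ≠ 0} :=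
  rfl

end Comp

end Summit.KontsevichZagierPeriods.KontsevichZagierPeriods.Theorems
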